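import Literature.Computability.QuantumComplexity.GRKitPlugFP
import Literature.Computability.QuantumComplexity.GRDataPosFP
import Literature.Computability.QuantumComplexity.GRInsValsFP
import Literature.Computability.QuantumComplexity.GRLevelWordDesc
import Literature.Computability.QuantumComplexity.GRStageAbstract
import HarnessLib

/-!
# The abstract word of the standard Grover–Rudolph block, indexed by naturals, and on codes (stage S3 of the sampler's uniformity)

Topic `Literature/Computability/QuantumComplexity`; stage S3 of the UNIFORMITY of Regev's sampler ([Regev2009, Lemma 3.14, proof];
Arora–Barak §6.2). `GRStageAbstract.lean` computes the abstract gate list of a Grover–Rudolph block as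
`(List.finRange ℓ).flatMap (GRStage.levelA D)`; `GRLevelWordDesc.lean` (`GRStage.levelsA_codeFP_of`) puts words of that shape on codes
GIVEN thirteen inputs on codes. For the STANDARD block data `GRData.data m hk1 ha hau` (`GRData.lean`: kit `GenKit.kit (ps kk) (ℓ+np+wlen) kk`,
point wires `j`, parameter wires `ℓ + t`, base `ℓ + np`, machine data `m`) every input but the machine's suffixes `v j` is now in the tree:
data positions `GRData.dposStd` (`GRDataPosFP.lean`), gadget input values (`GRInsValsFP.lean`), kit lists / flag program / flag wire
(`GRKitPlugFP.lean`). This file assembles them: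

* `GRStage.levelAN e M ℓ np wlen kk v j`, `GRStage.blockAN … := (List.range ℓ).flatMap (levelAN …)` — the level / block words over natural
  indices, the kit RECORD and a suffix function `v : ℕ → List Bool`, for a fixed machine `(e, M)`;
* the bridge **`GRStage.levelA_data_eq_levelAN`**: `levelA (GRData.data m hk1 ha hau) j = levelAN m.e m.M ℓ np wlen kk (vN m.v) j` and
  **`map_toAG_blockCircuit_data`**: `(blockCircuit (GRData.data m hk1 ha hau)).gates.map toAG = blockAN m.e m.M ℓ np wlen kk (vN m.v)`
  (`vN` extends `m.v : Fin ℓ → List Bool` by `[]`);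
* on codes **`GRStage.blockAN_codeFP_of (hℓ hnp hwlen hk : unE-valued) (hv : CodeFP (pairE eσ natE) strE (fun q => v q.1 q.2))
  (hN : CodeFP (pairE eσ natE) unE (fun q => q.2 + np q.1 + (v q.1 q.2).length)) : CodeFP eσ (rawE agE0) (fun c => blockAN e M (ℓ c) (np c) (wlen c) (kk c) (v c))`** —
  so the S3 stage word needs from the sampler only its suffix function on codes (`hv`, `hN`).

Everything is proved; no named fact is introduced.

## References

* O. Regev, J. ACM 56(6) (2009), Lemma 3.12 (proof), Lemma 3.14 (proof) [Regev2009].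
* S. Arora, B. Barak, *Computational Complexity: A Modern Approach*, CUP 2009, §6.2 [AroraBarak2009].
* L. K. Grover, T. Rudolph, arXiv:quant-ph/0208112 (2002), eq. (5) [GroverRudolph2002].
-/

noncomputable section

namespace Literature.Computability.QuantumComplexity

open _root_.Computability Cryptography Complexity Complexity.CodeFP SLP RevDesc AJLCore RevSim RevClean CleanPlaced Turing

namespace GRStage

section Words

variable (e : ℕ) (M : TM2ComputableAux Bool Bool) (ℓ np wlen kk : ℕ) (v : ℕ → List Bool)

/-- The standard gadget input values of level `j` (target wire `j`, then the flag-bit wires). [folklore] -/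
def insStd (j : ℕ) : List ℕ :=
  j :: (List.range kk).map (fun b => ℓ + np + (resW e M (j + np + (v j).length) b (CWrap.symTrue M) - (j + np)))

/-- The compiled Grover–Rudolph flag program. [folklore] -/
def progGR : List SLP.Instr × ℕ × ℕ × ℕ := (GRWord.prog kk).compile (thrWd kk) 0 0

/-- **The abstract word of level `j` of the standard block** over natural indices and the kit record. [cite: Regev2009, Lemma 3.12 (proof)] -/
def levelAN (j : ℕ) : List AG :=
  progA ((cleanOps e M (j + np) (v j)).map (ClOp.map (relabel (j + np) (GRData.dposStd ℓ np j) (ℓ + np)))) ++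
    (oaaWordA (sandwichA ((GenKit.gpOf (GRData.ps kk) (ℓ + np + wlen) kk).cr :: (GenKit.gpOf (GRData.ps kk) (ℓ + np + wlen) kk).as)
        (GenKit.gpOf (GRData.ps kk) (ℓ + np + wlen) kk).cr j
        ((GenKit.gpOf (GRData.ps kk) (ℓ + np + wlen) kk).gopsA (insStd e M ℓ np kk v j) (progGR kk)) []
        [(GenKit.gpOf (GRData.ps kk) (ℓ + np + wlen) kk).gflagA (progGR kk)])
      (reflectA (GenKit.gpOf (GRData.ps kk) (ℓ + np + wlen) kk).cr
        ((GenKit.gpOf (GRData.ps kk) (ℓ + np + wlen) kk).as ++ (GenKit.gpOf (GRData.ps kk) (ℓ + np + wlen) kk).region)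
        (GenKit.gpOf (GRData.ps kk) (ℓ + np + wlen) kk).hs) ++
      progA ((cleanOps e M (j + np) (v j)).map (ClOp.map (relabel (j + np) (GRData.dposStd ℓ np j) (ℓ + np)))).reverse)

/-- **The abstract word of the standard Grover–Rudolph block.** [cite: Regev2009, Lemma 3.12 (proof)] -/
def blockAN : List AG := (List.range ℓ).flatMap (levelAN e M ℓ np wlen kk v)

end Words

/-- A suffix family on `Fin ℓ` extended by `[]`. [folklore] -/
def vN {ℓ : ℕ} (v : Fin ℓ → List Bool) (j : ℕ) : List Bool := if h : j < ℓ then v ⟨j, h⟩ else []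

/-- `vN` on `Fin ℓ`. [folklore] -/
@[simp] theorem vN_coe {ℓ : ℕ} (v : Fin ℓ → List Bool) (j : Fin ℓ) : vN v j = v j := by
  unfold vN; rw [dif_pos j.2]

section Bridge

variable {ℓ np wlen kk : ℕ} {a : Fin ℓ → (Fin ℓ → Bool) → ℝ} (m : GRData.Mach ℓ np wlen kk a) (hk1 : 1 ≤ kk)
  (ha : ∀ j y, |a j y| ≤ 1) (hau : ∀ j y b, a j (Function.update y j b) = a j y)

/-- **Bridge for the level word of the standard block.** [cite: Regev2009, Lemma 3.12 (proof)] -/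
theorem levelA_data_eq_levelAN (j : Fin ℓ) :
    levelA (kit := GenKit.kit (GRData.ps kk) (ℓ + np + wlen) kk) (GRData.data m hk1 ha hau) j = levelAN m.e m.M ℓ np wlen kk (vN m.v) j := by
  unfold levelAN insStd progGR
  rw [vN_coe, ← GRData.insGR_val_eq m hk1 j]
  unfold levelA
  rw [GenKit.map_val_grOps, GenKit.val_grFlag, GenKit.kit_had_val, GenKit.kit_asRegion_val, GenKit.kit_hs_val, GRData.ws_val]
  simp only [GRData.dposP_eq_dposStd]
  rfl

/-- **The abstract gate list of the standard Grover–Rudolph block is `blockAN`.** [cite: Regev2009, Lemma 3.12 (proof), Lemma 3.14 (proof)] -/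
theorem map_toAG_blockCircuit_data :
    (blockCircuit (kit := GenKit.kit (GRData.ps kk) (ℓ + np + wlen) kk) (GRData.data m hk1 ha hau)).gates.map toAG =
      blockAN m.e m.M ℓ np wlen kk (vN m.v) := by
  rw [map_toAG_blockCircuit, blockAN, ← List.map_coe_finRange_eq_range, List.flatMap_map]
  exact List.flatMap_congr fun j _ => levelA_data_eq_levelAN m hk1 ha hau j

end Bridge

variable {σ : Type} {eσ : σ → List Bool} (e : ℕ) (M : TM2ComputableAux Bool Bool) {ℓ np wlen kk : σ → ℕ} {v : σ → ℕ → List Bool}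
  (hℓ : CodeFP eσ unE ℓ) (hnp : CodeFP eσ unE np) (hwlen : CodeFP eσ unE wlen) (hk : CodeFP eσ unE kk)
  (hv : CodeFP (pairE eσ natE) strE (fun q => v q.1 q.2)) (hN : CodeFP (pairE eσ natE) unE (fun q => q.2 + np q.1 + (v q.1 q.2).length))
include hℓ hnp hwlen hk hv hN

/-- **The standard Grover–Rudolph block word on codes**, for a fixed machine, from the block's four sizes in unary and the suffix
function on codes. [cite: Regev2009, Lemma 3.14 (proof)] [cite: AroraBarak2009, §6.2 (proof of Thm. 6.15)] -/
theorem blockAN_codeFP_of : CodeFP eσ (rawE agE0) (fun c => blockAN e M (ℓ c) (np c) (wlen c) (kk c) (v c)) := by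
  have hd : CodeFP eσ unE (fun c => ℓ c + np c + wlen c) := BP.uadd (BP.uadd hℓ hnp) hwlen
  have hins : CodeFP (pairE eσ natE) (rawE natE) (fun q => insStd e M (ℓ q.1) (np q.1) (kk q.1) (v q.1) q.2) :=
    (GRData.insValsStd_codeFP_of e M hℓ hnp hk hN :)
  have hbase : CodeFP eσ natE (fun c => ℓ c + np c) := GRData.baseStd_codeFP_of hℓ hnp
  have hcr : CodeFP eσ natE (fun c => (GenKit.gpOf (GRData.ps (kk c)) (ℓ c + np c + wlen c) (kk c)).cr) := (GenKit.crA_codeFP_of hd hk :)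
  have hdpos : CodeFP (pairE (pairE eσ natE) natE) natE (fun q => GRData.dposStd (ℓ q.1.1) (np q.1.1) q.1.2 q.2) := GRData.dposStd_codeFP_of hℓ hnp
  have ht : CodeFP (pairE eσ natE) natE (fun q => q.2) := snd _ _
  have hflag : CodeFP (pairE eσ natE) natE (fun q => (GenKit.gpOf (GRData.ps (kk q.1)) (ℓ q.1 + np q.1 + wlen q.1) (kk q.1)).gflagA (progGR (kk q.1))) :=
    ((GenKit.grFlagA_codeFP_of hd hk).comp (fst _ _) :)
  have hgops : CodeFP (pairE eσ natE) (rawE clopE) (fun q => (GenKit.gpOf (GRData.ps (kk q.1)) (ℓ q.1 + np q.1 + wlen q.1) (kk q.1)).gopsA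
      (insStd e M (ℓ q.1) (np q.1) (kk q.1) (v q.1) q.2) (progGR (kk q.1))) := (GenKit.grOpsA_codeFP_of (ins := fun c j => insStd e M (ℓ c) (np c) (kk c) (v c) j) hd hk hins :)
  have hhad : CodeFP eσ (rawE natE) (fun c => (GenKit.gpOf (GRData.ps (kk c)) (ℓ c + np c + wlen c) (kk c)).cr ::
      (GenKit.gpOf (GRData.ps (kk c)) (ℓ c + np c + wlen c) (kk c)).as) := (GenKit.hadA_codeFP_of hd hk :)
  have hasreg : CodeFP eσ (rawE natE) (fun c => (GenKit.gpOf (GRData.ps (kk c)) (ℓ c + np c + wlen c) (kk c)).as ++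
      (GenKit.gpOf (GRData.ps (kk c)) (ℓ c + np c + wlen c) (kk c)).region) := (GenKit.asRegionA_codeFP_of hd hk :)
  have hhs : CodeFP eσ (rawE natE) (fun c => (GenKit.gpOf (GRData.ps (kk c)) (ℓ c + np c + wlen c) (kk c)).hs) := (GenKit.hsA_codeFP_of hd hk :)
  have H := levelsA_codeFP_of (e := e) (M := M) (ℓ := ℓ) (np := np) (base := fun c => ℓ c + np c)
    (cr := fun c => (GenKit.gpOf (GRData.ps (kk c)) (ℓ c + np c + wlen c) (kk c)).cr) (v := v)
    (dpos := fun c j i => GRData.dposStd (ℓ c) (np c) j i) (t := fun _ j => j)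
    (had := fun c => (GenKit.gpOf (GRData.ps (kk c)) (ℓ c + np c + wlen c) (kk c)).cr :: (GenKit.gpOf (GRData.ps (kk c)) (ℓ c + np c + wlen c) (kk c)).as)
    (asreg := fun c => (GenKit.gpOf (GRData.ps (kk c)) (ℓ c + np c + wlen c) (kk c)).as ++ (GenKit.gpOf (GRData.ps (kk c)) (ℓ c + np c + wlen c) (kk c)).region)
    (hs := fun c => (GenKit.gpOf (GRData.ps (kk c)) (ℓ c + np c + wlen c) (kk c)).hs)
    (flag := fun c _ => (GenKit.gpOf (GRData.ps (kk c)) (ℓ c + np c + wlen c) (kk c)).gflagA (progGR (kk c)))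
    (gops := fun c j => (GenKit.gpOf (GRData.ps (kk c)) (ℓ c + np c + wlen c) (kk c)).gopsA (insStd e M (ℓ c) (np c) (kk c) (v c) j) (progGR (kk c)))
    hℓ (BP.toNat hnp) hbase hcr hv hN hdpos ht hflag hgops hhad hasreg hhs
  unfold blockAN levelAN
  exact H

end GRStage

end Literature.Computability.QuantumComplexity

end
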